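import Summits.HubbardSuperconductivity.HubbardSuperconductivity.Theses.AposterioriCapRg

/-!
# Disproof work file of `SeededBrokenRegimeBoseFermiPinned` (stmt-HubbardSuperconductivity-14047)

Standing disprover `refuter-cdisprove-stmt-HubbardSuperconductivity-14047-0`, cycle 1 (2026-08-16); EXTENDED by
seat `…-14047-g2-0`, cycle 2 (2026-08-16, `## Cycle 2` below: F1 RETRACTS cycle 1's §6(a) — the anomalous `B₁g`
block is MARGINAL, so `∀ etaStar` is unmeetable and `[2′] → ¬S` on paper; §7–§10 are the cycle-2 checked sections);
EXTENDED by seat `…-14047-g3-0`, cycle 3 (2026-08-16, `## Cycle 3` below: the negative lemma RE-LANDED after the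
relocation bounce of p80926; F6 frame freedom — far-shell admissible frames neither rescue `∀ etaStar` nor are excluded,
§11 checked; §12 target S4 `stub_anchorFlow` modulo an anchor floor; §13 the normal form of `¬S`).
Crux `[3]` of route AposterioriCapRg (rank 3):

  `∀ kStar etaStar > 0, ∃ Θ, ∀ (U, δ, μ) in the box with the density clause, ∀ K Λ L₀,`
  `  symmetricRegimeCertificateT U μ capRgCornerDataT Θ K Λ L₀ → Concl kStar etaStar U μ`,

`Concl` = `∃ h₀ > 0, ∃ D, D.MeetsThresholds kStar etaStar ∧ 0 < D.numPatches ∧ 0 < D.meanFieldDensity.fst ∧`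
`∀ h ∈ (0, h₀], ∃ L₀', D.IsCertifiedEnclosure (hubbardScaleReportCT U μ D h) L₀'`.

## Findings (all kernel-checked below unless marked ON PAPER)

* **No unconditional kill is reachable, and WHY** (§0): `¬S` in normal form needs (i) an INSTANCE
  of the v3 certificate at some point of the box — that is exactly crux `[2]`
  `CapRgSymmetricCertificatePinned` (stmt-14045), which nobody can construct (a computer-assisted
  RG at `U = 3`) — and (ii) the failure of `Concl` there, i.e. an `h`-uniform statement about
  `scaleStiffnessCT` / `scaleMeanFieldDensityCT` / `scaledRemainderNormCT` of the MODEL at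
  `U ∈ [2,3]`; the tree evaluates these functionals only at `U = 0`
  (`hubbardEffectiveActionCT_free_zero_frame`, `isRealisedAtCT_free_noPatch`).  Symmetrically no
  proof of `S` is reachable.  Every kernel-checkable statement about this crux is RELATIVE.
* **§1 read-back** `crux_iff` (`Iff.rfl`) with named pieces `Dens`, `Concl`.
* **§2 the tolerance is antitone** (`certifiedAtT_mono_tol`, `certificateT_mono_tol`,
  `body_antitone`): a certificate at tolerance `Θ` is one at every componentwise larger `Θ'`, so the
  body of the crux at `Θ'` implies the body at every `Θ ≤ Θ'` — the set of admissible tolerances is a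
  down-set: WLOG `Θ` is as small as the prover likes (the burden `∀ Θ` sits on `[2]`).
* **§3 vacuity transport** (`crux_of_uninstantiable`, `instantiated_of_capRg`): if SOME positive
  tolerance is never certified in the box the crux holds with no content; conversely under `[2]`
  every tolerance is certified at `[2]`'s point, so under `[2]` the crux is exactly as strong as
  `Concl` at that point for all thresholds.
* **§4 load-bearing analysis MODULO `[2]`** (the only available source of a certified point):
  - `concl_etaStar_nonneg`: `Concl kStar etaStar U μ → 0 ≤ etaStar` UNCONDITIONALLY (reported
    remainder norms are `≥ 0`): the hypothesis `0 < etaStar` cannot be weakened past `0 ≤`;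
    `not_cruxAnyEta_of_capRg : [2] → ¬ CruxAnyEta` (the crux with the sign condition on `etaStar`
    dropped is false at `[2]`'s point, witness `etaStar = -1`).  Whether `etaStar = 0` (an EXACT normal
    form) is attainable is model content (open).
  - `not_cruxUniformDatum_of_capRg : [2] → ¬ CruxUniformDatum`: ONE datum `D` cannot meet all
    stiffness thresholds (`kStar · Λ₀ · v_F.snd ≤ ρ_s.fst` fails for
    `kStar = (|ρ_s.fst| + 1)/(Λ₀ v_F.snd)`, `not_forall_meetsThresholds`, pure `ℚ`-arithmetic) — the
    quantifier order `∀ kStar etaStar … ∃ D` is load-bearing; `crux_of_cruxUniformDatum` records that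
    it IS a strengthening.
  - `0 < kStar` is NOT load-bearing for falsity: the three stiffness clauses only get weaker for
    `kStar ≤ 0` except `(kStar Λ₀)² ≤ ρ_s κ`, which is even in `kStar` (remark, no theorem needed).
  - the density clause `Dens` and `δ` do not occur in `Concl` nor in the certificate: dropping them
    gives the STRONGER statement `CruxNoDens` (`crux_of_cruxNoDens`); a prover will in fact prove
    `CruxNoDens` (the certificate alone drives the proof) — information, not an objection.
* **§5 conclusion-side structure (UNCONDITIONAL; refines rattack-14042-g2's C1).**  In
  `IsRealisedAtCT … nodal p` the velocities `p.fermiVelocity`, `p.gapVelocity` occur ONLY in the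
  nodal pins `∀ i ∈ nodal, NodalConditionCT …`.  Hence for a datum with EMPTY NODAL SET (any
  `numPatches`, so `0 < D.numPatches` does not help) the report is invariant under re-assigning the
  velocities (`isRealisedAtCT_setVel`, `mem_reportCTAt_setVel`, `isCertifiedEnclosure_withVel`), and
  in `Concl` the two velocity enclosures can be replaced by the point interval `[ε, ε]` for every
  small rational `ε > 0` without touching the model (`concl_velocities_decorative`): the clauses
  `kStar Λ₀ v_F ≤ ρ_s`, `kStar Λ₀ v_Δ ≤ ρ_s` of `MeetsThresholds` then certify nothing beyond
  `0 < ρ_s.fst`.  Consequence for the route: the consumer R (stmt-13884) must not use `v_F`, `v_Δ`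
  of a datum unless `D.nodal.Nonempty`; for `[3]` it is a (harmless) extra freedom.  A d-wave datum is
  expected to declare the four diagonal patches nodal (the min-modulus gap on a patch-shell containing
  a node is `< 10 Λ₀` for large `L`), so this is a typing remark, not a refutation handle.
* **§6 ON PAPER (heuristic power counting of the conclusion's norm; recorded for the provers,
  NOT a claim).**  Probe: is `∀ etaStar ∃ D` defeated by a FLOOR of the scaled remainder norm
  `η = Σ_m Λ₀^{-(2m-3)} ‖R_m‖` coming from terms the purely fermionic kept form omits?  Candidates:
  (a) the anomalous `4+0 / 0+4` pair-pair vertex `W` of the broken regime — printed: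
  EberleinMetzner2014 p. 3 ("In a superfluid state also anomalous interactions appear. A coupling
  function `W` describes the destruction or creation of four electrons …  amplitude and phase
  coupling functions `A = P + W`, `Φ = P - W`"), the phase channel `Φ_d` carrying the Goldstone
  singularity, so `|W_d| ≈ |P_d| ≈ ½ g_phase`, `g_phase(0) ≈ V/(h/Δ₀ + c λ Λ₀/Δ₀)` (the below-scale
  window regularises it `h`-uniformly at fixed `Λ₀`); `cooperKeptCT` keeps the monomial
  `ψ⁺↑ψ⁺↓ψ⁻↓ψ⁻↑` only, so `W` is charged to the remainder at weight `Λ₀⁻⁵`; (b) the `1PR` sextic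
  trees `g C^{>} g` (weight `Λ₀⁻⁹`).  Leg-by-leg count with the energy weights `√(Λ₀/max(Λ₀,E))`,
  the pair disc `|k₁ + k₂| ≲ Λ₀/v_F` where `g` is large, and the `B₁g` form factor `d_k`, whose zero
  at the nodes exactly compensates the unit nodal weight (`|d_k|·wt(k)·wt(-k) ≲ Λ₀/Δ₀` uniformly):
  (a) `≈ 1.4·10⁻⁴ v_F⁻² (Λ₀/Δ₀)`, (b) `≈ 10⁻⁹ (Λ₀/Δ₀)²` — BOTH IRRELEVANT, no floor found; the
  `∀ etaStar` design survives this probe (a first count WITHOUT the form-factor zeros had suggested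
  growth `(Δ₀/Λ₀)^{5/2}` for (b): wrong, recorded so nobody repeats it).  What the probe does show:
  the kept coefficient `cooperCoefficientCT(q)` must be allowed to be as large as `Δ₀/(N_F Λ₀)`
  (it is: unconstrained), and any kept form WITHOUT the `B₁g` zeros (e.g. an `s±` admixture) would
  have a floor.
* **LANDED (p76062, commit c9a218d443c4)**: `Theorems/SeededBrokenRegimeBoseFermiPinned/Negative/LoadBearing.lean`
  — the §2, §4, §5 theorems with all statements inlined (names `certifiedAtT_mono_tol`,
  `certificateT_mono_tol`, `seededBrokenRegime_body_antitone`, `seededBrokenRegime_concl_etaStar_nonneg`,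
  `seededBrokenRegime_anyEta_false_of_capRg`, `hubbardScaleData_not_forall_meetsThresholds`,
  `seededBrokenRegime_uniformDatum_false_of_capRg`, `isRealisedAtCT_setVel`,
  `mem_hubbardScaleReportCTAt_setVel`, `isCertifiedEnclosure_setVel`,
  `seededBrokenRegime_concl_velocities_decorative`, namespace `…Theorems.SeededBrokenRegimeBoseFermiPinned.Negative`);
  ideators / planners / the lead may import that module.
* **Targets**: none yet (no line picked, `stuck_stubs = []`).

## Census of attacks (cycle 1)

decide/simp/aesop on `S`, `¬S`, `Concl`: fail (rattack-14047, re-run: not decidable) · junk `Θ`: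
excluded by `SymmetricTolerance` positivity · junk `D` (`Np = 0`: excluded by `0 < numPatches`;
`nodal = ∅`: velocities free §5 but `(kStar Λ₀)² ≤ ρ_s κ`, `0 < m₀` and the gap threshold still read
the model; empty-shell / off-band frames: gap `0` fails `10 Λ₀`, nodal `v_F = 0` fails `0 < v_F.fst`)
· `etaStar ≤ 0`: §4 · uniform `D`: §4 · `U = 0`: outside `[2,3]`, and the v3 certificate is false at
`(U, K) = (0, 0)` (`not_symmetricRegimeCertificateT_free`) · barriers WeakCouplingCeiling(Narrow),
PerturbativeInvisibilityOfPairing: do not bite a conditional fixed-`U` statement · negatives index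
(`AposterioriCapRgKlsOrderOpenness_refuted` only): unrelated · literature (`lit search` degraded on
this hub at session time, see NOTES): no printed counterexample to an `h`-uniform Bose–Fermi
normal form is known to this seat; nearest: EberleinMetzner2014, SalmhoferEtAl2004 §4.2, BFKT2017.

## Cycle 2 (seat refuter-cdisprove-stmt-HubbardSuperconductivity-14047-g2-0, 2026-08-16) — findings

VERDICT: still NO UNCONDITIONAL KILL (F2 makes the obstruction a theorem), but an ON-PAPER kill modulo the
producer: **`[2′] → ¬S`** by a MARGINAL remainder floor (F1), kernel-packaged as `¬S` modulo
`AnomalousBlockFloorHyp` (§9) and filed on the negative-modulo lane.  Cycle 1's §6(a) is RETRACTED.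

* **F1 (ON PAPER; §9 for the checked shell; evidence FLOOR_c2.md; numerics job j011823, circular-FS toy).
  The anomalous `B₁g` block has a MARGINAL, `h`-uniform scaled norm — cycle-1 §6(a) retracted.**
  (i) MASS.  Below the condensation scale the Wilsonian action `𝒢 = hubbardEffectiveActionCT … h K Λ₀`
  (`= -log ∫ dμ_{C^{K,>}} e^{-V}`, HubbardScaleReportCT §2) is the generating functional of a
  SYMMETRY-BROKEN above-scale subsystem (the modes with `ω² + e_K² > Λ₀²` alone satisfy the gap equation up
  to `O(Λ₀²/Δ₀²)`), pinned ONLY by the seed: in the collective-field representation the transverse curvature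
  of the effective potential at its minimum is `seed/|φ_s| ∝ h` EXACTLY (U(1) covariance), i.e. the transverse
  pair-fluctuation exchange among below-scale legs is `V_⊥(q) = 1/(K(q) + a_h)`, `a_h ∝ h`,
  `K = K_τ ν² + K_x q⃗² + …`, `K_τ = N_F/(4Δ₀²)`, `K_x = N_F v_F²/(8Δ₀²)` (T = 0 BCS; the vertex `f²` cancels
  `1/Δ(θ)²` angle by angle).  This is SalmhoferEtAl2004 §4.2 verbatim (held: arXiv:cond-mat/0409725 p. 10,
  "θ(s) = g₀/(1 - g₀∫_{ε_s}^∞ dE Ñ(E)(1/2ℰ)tanh(βℰ/2)) = g₀ δ(s)/δ₀ … the exact solution for the tangential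
  vertex.  It diverges in the limit δ₀ → 0") and it is what BARRIER_NOTES BN3 and card
  rotation-identity-goldstone-pin assert.  Cycle 1's "the below-scale window regularises `g_phase(0)` at
  mass² `∝ Λ₀Δ₀`" conflated the fully self-consistent 1PI vertex (below-scale modes contribute `χ^<`) with the
  Wilsonian action (below-scale modes are EXTERNAL legs): wrong, withdrawn.
  (ii) WHAT IS KEPT.  `V_⊥ B_π B_π`, `B_π = i(B̄_f - B_f)`, contains `B̄B` (KEPT: `cooperKeptCT` keeps exactly
  the monomial `ψ⁺↑ψ⁺↓ψ⁻↓ψ⁻↑` with a free coefficient `D̂(q)`, HubbardScaleReportCT l. 709–716) AND the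
  ANOMALOUS block `W = ½V_⊥(q)(BB + B̄B̄)` (minus the regular amplitude-channel part), NOT kept ⇒ in `R₄`
  with weight `Λ₀⁻⁵` (EberleinMetzner2014 §III: `A = P + W` regular, `Φ = P - W` singular ⇒ `|W| ≈ |P|`).
  (iii) THE COUNT (`legKernelNorm`/`weightedKernel` conventions: kernel = coefficient/4!, `ε⁻⁴`, so a term
  `ε³ Σ F ψ⁴` has norm `(mult/4) sup_{k₁} wt₁ ∫dk₂dk₃ wt₂wt₃wt₄|F|`, `∫dk = ∫dω d²k/(2π)³`):
  `N_W = Λ₀⁻⁵ (mult/4) sup_{k₁} wt₁ ∫dk₂ wt₂|f₁₂| |W(k₁+k₂)| J(k₁+k₂)`, `J(q) = ∫dk₃ wt₃wt₄|f₃₄|`.  Every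
  gapped below-scale pair carries `wt·wt·|f| = (Λ₀/(Δ₀|f|))·|f| = Λ₀/Δ₀` (the `B₁g` zeros cancel the unit
  nodal weights EXACTLY as cycle 1 observed; nodal pairs give the same); `J(0) = πΛ₀²·∮ds·Λ₀/Δ₀/((2π)³v_F)
  = Λ₀³k_F/(4πv_FΔ₀)` (circular); the `k₂`-integral ACROSS THE POLE is `∫d³q ½V_⊥` over the below-scale slab
  `|ν| ≤ 2Λ₀`, `|q_⊥| ≲ 2Λ₀/v_F`, `q_∥ ∈ ℝ`: `= ∫dν dq_⊥ π/(2√K_x √(K_τν² + K_x q_⊥² + a_h)) ∝ Λ₀/√(K_xK_τ)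
  ∝ Δ₀²Λ₀/(N_F v_F)` — LINEAR in `Λ₀` and FINITE as `a_h → 0` (the pole is integrable in `2+1` dimensions).
  Powers: `Λ₀^{-5+1+1+3} Δ₀^{-1+2-1}`: **`Λ₀⁰ Δ₀⁰ h⁰` — MARGINAL, `h`-UNIFORM**; constant (FLOOR_c2.md §4:
  the `(ω₂, e₂)` disc maps to an ellipse around the pole, `∫∫dxdy/r ≈ 5.15√K_τΛ₀`):
  `c_W ≈ 0.033·mult/v_F²` ⇒ `8·10⁻³·mult` at `v_F = 2`, `mult ∈ [1, 2]` (relabelling multiplicity, `2` natural;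
  amplitude-channel subtraction, smooth window, real-curve geometry are `O(1)`): **`c_W ≈ 4·10⁻³–4·10⁻²`** over
  the corner's `v_F ∈ [1.24, 2.81]`; TRIAGE-r1-2 I1's independent count `(ℓ+1)/(4π²αv_F²) ≈ 0.005–0.15`, BN1
  `0.02–0.2` (same `1/v_F²` structure).  Numerics (job j011823, pending at publication: circular FS,
  `Δ₀/Λ₀ ∈ {3,10,30,100}`, `m_h/Λ₀ ∈ {1, 0.3, 0.1, 0.03}`, expected level `≈ 8·10⁻³` flat in both) attach
  themselves to the item; its pure-python lite version RAN on the hub (`calc/floor_W_lite.py`, FLOOR_c2.md §4(f)):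
  `sup N_W = 4.45·10⁻³ / 6.59·10⁻³` (`m_h = 0.3Λ₀ / 0.03Λ₀`) IDENTICAL at `Δ₀/Λ₀ = 10, 30, 100` (marginal to three
  digits) and convergent to `6.8·10⁻³` as `m_h/Λ₀ → 10⁻³` (h-uniform), at `v_F = 2`, `mult = 1`.
  (iv) THE TOWER.  In the `θ`-parametrisation the condensate couples through `Δ₀ θ^k B` (`k ≥ 1`), so the
  `n`-pair trees have `n-1` propagators and scaled size `Λ₀^{-(4n-3)+1+3(n-1)+3(n-1)-2(n-1)} = Λ₀⁰` for
  EVERY `n`: an infinite tower of MARGINAL remainders with constants `~c_W^{n-1}` (sextic `B_σB_πB_π`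
  `≈ (4/3)·mult₆·c_W² ≈ 6·10⁻⁵–4·10⁻⁴` over the corner, FLOOR_c2.md §5); NOTHING relevant (the naive linear-σ count `Λ₀⁻²` for four external `π` legs is the
  Adler zero: σ-exchange and `π⁴` contact cancel at zero momentum); the nodal current (Doppler) coupling
  `∇θ·j` is irrelevant (`Λ₀¹`), as the route says; the normal–anomalous MIXING block (EberleinMetzner2014's `X`,
  three legs in / one out; the route's `S_mix = ∂_τθ·n`) is marginal by the same count (the `ν` of the `∂_τθ` vertex
  supplies the power of `Λ₀` that the ungapped nodal particle–hole weights lose; constant not estimated) and is not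
  kept either.  So `∀ kStar` is NOT hit by this probe (`Λ₀ → 0` is harmless for marginal terms); `∀ etaStar` IS.
  (v) CONSEQUENCE.  At every point whose scale-`Λ₀` action is the intended `d`-wave condensate,
  `inf_D η ≥ c_W - o(1) > 0` uniformly in `h ≤ h₁` and `Λ₀ = D.scale ≤ Λ₁` ⇒ `Concl(kStar, etaStar)` is FALSE
  for `etaStar < c_W` ⇒ the body fails at every certified point ⇒ **`[2′] → ¬S`** (F2's `[2′]`; checked shell:
  `crux_false_of_floor`, `crux_false_of_capRgFloor`, `crux_false_of_anomalousBlockFloorHyp`; the semantic entry points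
  `noSmallRemainderData_of_tupleFloor` and `reportFloor_of_realisedFloor`).  CLASS, for
  the day `[2′]` is constructed: refuted-MISSTATED — the misstatement is the REPORT's kept sector (D1″
  `cooperKeptCT` keeps the number-conserving half of the phase-mode exchange), not the thesis.  REPAIRS for
  the planner: (D1‴-min) kept sector := the Nambu `B₁g ⊗ B₁g` block `{B̄B, BB, B̄B̄}` with free
  `q`-coefficients — removes `c_W`, leaves the sextic tower `≈ 10⁻⁴`, so `∀ etaStar` stays false IN
  PRINCIPLE; (D1‴-θ) the phase as an honest field in the report — the route's own thesis ("the phase MUST be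
  a field"), removes the tower, and R's Gaussian-phase core reads `S_phase` directly; (α) LITERAL thresholds
  `(kStar₀, etaStar₀)` shared with R, `etaStar₀` above the floor of whatever kept sector is chosen (then
  `c_W` must be computed at the corner).  Every crux idea card survives D1‴ (triage r1).
* **F2 (§8, checked): hardness transfer.**  `capRgPointwise_of_not_crux : ¬S → [2′]` and
  `crux_or_capRgPointwise : S ∨ [2′]`, `[2′] := ∀ Θ, ∃ (U,δ,μ) ∈ box, Dens ∧ ∃ K Λ L₀, Cert Θ` (the point may
  depend on `Θ`; `[2] → [2′]`): any refutation of `[3]` must run the CAP at `U ∈ [2,3]` AND prove the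
  thermodynamic-limit density clause.  The cycle-1 negative lemmas hold modulo the weaker `[2′]`
  (`not_cruxAnyEta_of_pointwise`, `not_cruxUniformDatum_of_pointwise`).
* **F3 (§7, checked): normal forms.**  `concl_mono`/`body_mono_thresholds` (thresholds), `crux_iff_nat`
  (`S ↔ ∀ n ∃ m, Body (n+1) (1/(n+1)) (diagTol (1/(m+1)))` — a `∀∃` over `ℕ` in front of the model),
  `body_iff_exists` (`K, Λ, L₀` are inert: only "some certificate at the point" is read).
* **F4 (§8, checked): `[2′]` already closes the route's glue** (`fixedPoint_of_pointwise :
  [2′] → S → R → FixedPointDWaveOrder`): the producer may choose its point per accuracy — `[2]`'s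
  `∃ point ∀ Θ` is stronger than the chain needs (planner information; positive glue, not landed by me).
* **F5 (remark, not a theorem): where `S` could become cheaply TRUE.**  `∃ Θ` is witnessed by any
  uninstantiable `Θ` (§3); the one concrete mechanism on record is the `∀ c₀` regularity demand on the frame
  (`[2]`-Disproof A8: the closed `coeffNorm₄ ≤ 10` ball must contain an exact FST counterterm at `U = 3` —
  `C⁴`-type regularity where print gives `C²`-type in `d = 2`); if a seat ever proves some `Θ₀` uncertifiable
  in the box, `[3]` closes vacuously and the route dies at `[2]` instead.  Not pursued here (it is `[2]`'s).
* **LANDING (cycle 2)**: `Theorems/SeededBrokenRegimeBoseFermiPinned/Negative/HardnessTransfer.lean`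
  (`capRgPointwise_of_not_seededBrokenRegimeBoseFermiPinned`, `seededBrokenRegime_concl_mono`,
  `seededBrokenRegime_not_concl_of_datumFloor`; `--supports`) and
  `…/Negative/SeededBrokenRegimeBoseFermiPinnedFalseOfFloor.lean` (`AnomalousBlockFloorHyp`,
  `SeededBrokenRegimeBoseFermiPinned_false_of_AnomalousBlockFloorHyp`, `datumFloor_of_tupleFloor`;
  `--negative-modulo AnomalousBlockFloorHyp`) — proposal ids in NOTES/the item notes.
* **Census additions (cycle 2)**: literature SalmhoferEtAl2004 §4.2 READ (held text p. 10) — supports BN3,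
  kills cycle-1 §6(a)'s mass; `lit search` still degraded (searchd rc 75, 03:30Z); power counting of the
  anomalous block, the sextic/octic phase trees (linear-σ vs θ parametrisation reconciled by the Adler zero)
  and the Doppler coupling; numerics j011823 queued behind 1.5k jobs at publication.  **Targets (§10)**: line
  `seed-strength-flow` PICKED at 04:14Z — S5 `stub_seedLowering` inherits the `∀ etaStar` floor (its premise "the
  transverse ladder is housed in `cooperKeptCT`" is F1's misstatement): `stub_seedLowering_false_of_targetFloorHyp`
  (modulo certificate instantiation + floor + anchored data); S4 `stub_anchorFlow` false only below `≈ (2–4)·10⁻⁵`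
  (massive anchor `m ≈ 12–20Λ₀` suppresses the anomalous block by `≈ (2.5–6)·10⁻³`, still marginal).  Evidence note
  `CdisproveStubSeedLowering.md` (crux dir) = item evidence `stub_seedLowering.md`.

## Cycle 3 (seat refuter-cdisprove-stmt-HubbardSuperconductivity-14047-g3-0, 2026-08-16) — findings

VERDICT: unchanged — NO UNCONDITIONAL KILL (`¬S → [2′]`), `¬S` modulo `AnomalousBlockFloorHyp`; cycle 2's F1 re-derived
independently and found ROBUST against the report's frame freedom (F6).  The cycle-2 landing FAILED and is re-filed (F7).

* **F7 (bookkeeping, the reason this cycle exists).**  Cycle 2's negative lemma p80926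
  (`Negative/SeededBrokenRegimeBoseFermiPinnedFalseOfFloor.lean`, `--negative-modulo AnomalousBlockFloorHyp`) was BOUNCED with
  its gate-generated Literature half p80918: the gate relocates a closed `def H : Prop` written under `Summits/` to
  `Literature/<topic>/H.lean`, building that file from `import Mathlib` + the NON-`Summits` imports of the proposal + the
  proposal's `open` lines; cycle 2's file imported only the Theses module and opened `Summit.…Theses.AposterioriCapRg`, so
  the generated file had no `Literature.MathematicalPhysics.QuantumLattice` import and an unknown namespace
  (`unknown namespace … / Unknown identifier SymmetricTolerance, TrigPolyC4v, …`).  RE-FILED as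
  `Negative/SeededBrokenRegimeBoseFermiPinnedFalseOfAnomalousBlockFloorHyp.lean` (folder `FalseOfFloor.lean`, rc 0, 0 warnings,
  axioms `propext/Classical.choice/Quot.sound`): explicit `import Literature.…DWaveSource/SymmetricRegimeCertificateT/
  HubbardScaleReportCT`, NO `open Summit…`, `H` fully qualified with `[folklore] [topic MathematicalPhysics/QuantumLattice]`
  (Literature-only simulation of the relocated file `sim/P1Sim.lean` rc 0), the core `not_concl_of_datumFloor` inlined.  Content:
  `SeededBrokenRegimeBoseFermiPinned_false_of_AnomalousBlockFloorHyp` (`H → ¬S`), `seededBrokenRegime_false_of_capRg_of_floor`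
  (**`[2]` + a floor at every v3-certifiable point ⇒ `¬[3]`** — under the floor the route's producer and consumer cruxes are
  jointly inconsistent), `not_seededBrokenRegimeBoseFermiPinned_iff` (§13), `capRgPointwise_of_anomalousBlockFloorHyp`.
  Proposal ids in the seat's NOTES / the item notes (gate socket down 05:50–06:10Z at first attempts).
* **F6 (ON PAPER, §11 for the checked shell): FRAME FREEDOM neither rescues `∀ etaStar` nor is excluded by `0 < numPatches`.**
  The report `∃`-binds an admissible frame `K` (`coeffNorm₂ K ≤ 16`) per `(M, δ)` INSIDE the realised set.  (0) CHECKED: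
  constant frames `K ≡ c`, `|c| ≤ 16`, are admissible (`isAdmissibleFrame_constFrame`); in such a frame `e_K` is the bare band
  at chemical potential `μ + c` (`nambuXiCT_constFrame`), the below-scale shell is `{|ε − μ − c| < Λ₀}` (`inShellCT_constFrame`,
  `hubbardCutoffWeightCT_constFrame`) and `∇e_K = ∇ε` (`bandGradientCT_constFrame`): for `|c| ≲ 4` the shell stays ON the torus
  (non-empty patch-shells, so the designers' "off-torus ⇒ gap 0 / v_F = 0" exclusion does not fire) but sits at distance `≈ |c|`
  in energy from the physical Fermi curve.  (i) In the normal form the shift `n ≡ c + Re Σ` restores the physical dispersion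
  (`E = √((e_K+n)² + Δ²) ≈ |c| ≫ Λ₀` on every below-scale leg, energy leg weights `√(Λ₀/|c|)`), `NodalConditionCT`'s FREE offset
  `s_i` (`e_K + n = s_i + (1+r_i)e_K + …`) admits "cones" displaced in energy by `≈ c` with the honest `v_F = |∇ε(κ_i)|`,
  `v_Δ = |∂_t Δ(κ_i)|`, and the `d`-wave gap data are honest (`|hφ_d + Δ(k)| ≈ Δ₀|f| ≥ 10Λ₀` off the diagonal patches).  So in a
  far-shell frame `Concl` needs NO renormalisation group: only LRO-type `h`-uniform positivity of `(m₀, ρ_s, κ)` — which there are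
  the responses of the (almost fully integrated) model, `m₀(h) > 0` uniformly iff LRO — plus a-priori `L¹–L^∞` bounds on the full
  model's vertex functions at far-shell momenta, suppressed by `(Λ₀/|c|)^{m/2}` (sharpens drefute's W1 "partially degenerate
  admissible frame"; consequence for R = stmt-13884: a certified far-shell datum certifies LRO only through `m₀`, tautologically).
  (ii) THE FLOOR PERSISTS in far-shell frames: the transverse-mode exchange `W ≈ ½V_⊥(q) g² f(k₁)f(k₃)(BB + B̄B̄)` has its pole at
  pair momentum `q = k₁ + k₂ = 0` wherever `k₁` sits (the HS vertex `φ̄B`, `B = Σ_k f(k)ψψ`, ranges over the whole zone), so the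
  count of F1(iii) becomes `Λ₀^{-5}·(Λ₀/c)²(four legs)·Λ₀(pole slab)·Λ₀²(J)` = `Λ₀⁰` — MARGINAL AGAIN, constant
  `≈ c_W·(Δ₀/|c|)² ~ 10⁻⁸–10⁻⁶` for `Δ₀ ∈ [0.003, 0.05]`, `|c| ≈ 4` (per below-scale pair the on-curve factor
  `wt·wt·|f| = Λ₀/Δ₀` of F1(iii) becomes `(Λ₀/|c|)|f|`; the INF over admissible frames is what a constructed floor must cite).  Hence
  `inf_D η > 0` uniformly in `h`, `Λ₀` AND the frame: `∀ etaStar ∃ D` stays unmeetable in principle; only the numerical floor an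
  eventual refutation can cite drops if the prover hides in a far shell.  (iii) Independent re-derivation of F1's count in the
  near-curve frame: `N_W ∝ Λ₀^{-5}·(Λ₀/Δ₀)(wt₁wt₂)·Λ₀Δ₀²/(N_Fv_F²)(pole slab)·Λ₀³k_F/(v_FΔ₀)(J(0)) = Λ₀⁰Δ₀⁰` ✓ (constant not
  re-evaluated; g2's `0.027–0.033/v_F²` stands).  (iv) Which modes condense: `N_FV_d log(W/Λ₀) = 1 + N_FV_d log 30 > 1` at
  `Λ₀ = Λ_c/30`, so the ABOVE-scale subsystem breaks `U(1)` by itself with gap `Δ₀(1 − O(Λ₀²/Δ₀²))`, its transverse curvature is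
  the seed term alone (`a_h ∝ h`), and integrating the auxiliary pair field at fixed below-scale `ψ` puts `½V_⊥(q)(B̄−B)²` into the
  Wilsonian action — F1(i) confirmed from the functional-integral side (Strack–Gersch–Metzner 2008, arXiv:0804.3994 §III B:
  "`V` is a normal two-fermion interaction in the Cooper channel, while `W` is an anomalous interaction corresponding to
  annihilation (or creation) of four particles", `2/m_σ² = V + W`; SalmhoferEtAl2004 §4.2 as in F1).
* **Targets (§12).**  `stuck_stubs = []`; the lead handed the line back (`promote-stub: stub_anchorFlow`, S5 second).  For the
  record before promotion: S4 `stub_anchorFlow` is false modulo an ANCHOR floor (`stub_anchorFlow_false_of_anchorFloorHyp`,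
  `kStar := 1`, `etaStar < c`): on paper the massive anchor (`m_⊥ ≈ 12–20Λ₀` at `h₀ = Λ₀/4`) suppresses the anomalous block to
  `c_anchor ≈ (2–4)·10⁻⁵` at `v_F = 2` (g2, `floor_W_lite_results.md`), far-shell frames by a further `(Δ₀/|c|)²` — "false in
  principle, harmless at literal thresholds"; S5 as in §10.  Advice to the planner restating S4/S5 as items: carry a LITERAL
  `etaStar₀` (fallback (α)) or restate over a `U(1)`-complete kept sector (D1‴-θ preferred: R's Gaussian-phase core reads
  `S_phase` directly; D1‴-min leaves the sextic tower `≈ 10⁻⁴`).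
* **Census additions (cycle 3)**: frame freedom (constant / far-shell admissible frames, all-nodal and displaced-cone
  declarations) → no kill, floor persists (F6) · `0 < D.meanFieldDensity.fst` at fixed `(L, β)`: `f_MF` is even in `h′`
  (`φ_d ↦ −φ_d` undone by `ψ ↦ iψ`), so `m₀(h) → 0` as `h → 0` at FIXED volume — harmless because `L₀′` may depend on `h`
  (the quantifier `∀ h ∃ L₀′` is load-bearing; the strengthening `∃ L₀′ ∀ h` is physically false, not kernel-checkable) ·
  literature (`lit search` remote cascade working, local FTS down): Strack–Gersch–Metzner 2008 READ (arXiv text pp. 7, 10, 13),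
  Eberlein 2014 thesis arXiv:1407.7661 and Pistolesi–Castellani–Di Castro–Strinati 2004 located (IR cancellations among
  Goldstone self-interactions — consistent with F1(iv): nothing RELEVANT, the obstruction is the marginal VALUE of an unkept
  block, not a running coupling) · no printed counterexample to an `h`-uniform Bose–Fermi normal form exists; the kill remains
  relative to `[2′]`.

-/

set_option linter.dupNamespace false

namespace Summit.HubbardSuperconductivity.HubbardSuperconductivity.Cruxes.SeededBrokenRegimeBoseFermiPinned.Disproof

open Summit.HubbardSuperconductivity.HubbardSuperconductivity.Theses.AposterioriCapRg
open Literature.MathematicalPhysics.QuantumLattice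

/-! ### §1 Read-back -/

/-- The density clause of the box (byte-identical with `FixedPointDWaveOrder` / `[2]`). -/
def Dens (U μ δ : ℝ) : Prop :=
  Filter.Tendsto (fun L : ℕ => ((hubbardTorusWith 2 (L + 1) 1 U μ).groundStateFunctional
    totalNumber).re / ((L + 1 : ℕ) : ℝ) ^ 2) Filter.atTop (nhds (1 - δ))

/-- The conclusion of the crux at thresholds `(kStar, etaStar)` and the point `(U, μ)`. -/
def Concl (kStar etaStar : ℚ) (U μ : ℝ) : Prop :=
  ∃ h₀ : ℝ, 0 < h₀ ∧ ∃ D : HubbardScaleData, D.MeetsThresholds kStar etaStar ∧ 0 < D.numPatches ∧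
    0 < D.meanFieldDensity.fst ∧
    ∀ h ∈ Set.Ioc (0:ℝ) h₀, ∃ L₀' : ℕ, D.IsCertifiedEnclosure (hubbardScaleReportCT U μ D h) L₀'

/-- The body of the crux at a given tolerance `Θ` and thresholds. -/
def Body (kStar etaStar : ℚ) (Θ : SymmetricTolerance) : Prop :=
  ∀ U ∈ Set.Icc (2:ℝ) 3, ∀ δ ∈ Set.Icc (1/5:ℝ) (7/20), ∀ μ : ℝ, Dens U μ δ →
    ∀ (K : TrigPolyC4v) (Λ : ℝ) (L₀ : ℕ),
      symmetricRegimeCertificateT U μ capRgCornerDataT Θ K Λ L₀ → Concl kStar etaStar U μ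

/-- Read-back: the crux is `∀ thresholds > 0, ∃ Θ, Body` — definitional. -/
theorem crux_iff :
    SeededBrokenRegimeBoseFermiPinned ↔
      ∀ kStar etaStar : ℚ, 0 < kStar → 0 < etaStar → ∃ Θ : SymmetricTolerance, Body kStar etaStar Θ :=
  Iff.rfl

/-! ### §2 The tolerance is antitone -/

/-- A point certificate at tolerance `Θ` is one at any tolerance with a larger mismatch constant
(`Λ ≥ 0`; `Θ` enters `SymmetricCertifiedAtT` only through `c₀ Λ` in clause (0b′)). -/
theorem certifiedAtT_mono_tol {π : SymmetricRegimeDataT} {Θ Θ' : SymmetricTolerance}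
    (hm : Θ.mismatch ≤ Θ'.mismatch) {a b : ℚ} {Λ : ℝ} (hΛ : 0 ≤ Λ) {L M : ℕ} [NeZero L] [NeZero M]
    {β : ℝ} {e : Literature.Probability.LatticeModels.TorusSite 2 L → ℝ} {G : HubbardGrassmann L M}
    {Z : ℂ} (h : SymmetricCertifiedAtT π Θ a b Λ L M β e G Z) :
    SymmetricCertifiedAtT π Θ' a b Λ L M β e G Z := by
  obtain ⟨h0, h1, h2, h3, h4, h5, h6⟩ := h
  refine ⟨h0, fun k hk σ => (h1 k hk σ).trans ?_, h2, h3, h4, h5, h6⟩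
  have : (Θ.mismatch : ℝ) * Λ ≤ (Θ'.mismatch : ℝ) * Λ :=
    mul_le_mul_of_nonneg_right (by exact_mod_cast hm) hΛ
  linarith

/-- The model certificate is monotone in the tolerance (componentwise order on `(c₀, w)`). -/
theorem certificateT_mono_tol {Θ Θ' : SymmetricTolerance} (hm : Θ.mismatch ≤ Θ'.mismatch)
    (hw : Θ.width ≤ Θ'.width) {U μ : ℝ} {π : SymmetricRegimeDataT} {K : TrigPolyC4v} {Λ : ℝ} {L₀ : ℕ}
    (h : symmetricRegimeCertificateT U μ π Θ K Λ L₀) : symmetricRegimeCertificateT U μ π Θ' K Λ L₀ := by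
  obtain ⟨h1, h2, h3, a, b, ha, hab, hb, hwid, hblock⟩ := h
  refine ⟨h1, h2, h3, a, b, ha, hab, hb, hwid.trans hw, ?_⟩
  intro L hL _
  obtain ⟨β₀, hβ₀⟩ := hblock L hL
  refine ⟨β₀, fun β hβ => ?_⟩
  obtain ⟨M₀, hM₀⟩ := hβ₀ β hβ
  exact ⟨M₀, fun M hM _ => certifiedAtT_mono_tol hm h2.pos.le (hM₀ M hM)⟩

/-- **The body is antitone in the tolerance**: if it holds at `Θ'` it holds at every componentwise
smaller `Θ` (fewer points are certified).  So "`∃ Θ`" may be witnessed as small as one likes. -/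
theorem body_antitone {kStar etaStar : ℚ} {Θ Θ' : SymmetricTolerance} (hm : Θ.mismatch ≤ Θ'.mismatch)
    (hw : Θ.width ≤ Θ'.width) (h : Body kStar etaStar Θ') : Body kStar etaStar Θ :=
  fun U hU δ hδ μ hd K Λ L₀ hc => h U hU δ hδ μ hd K Λ L₀ (certificateT_mono_tol hm hw hc)

/-! ### §3 Vacuity transport -/

/-- If some tolerance is certified NOWHERE in the box (with the density clause), the crux holds with
no content.  (Under `[2]` this never happens: `instantiated_of_capRg`.) -/
theorem crux_of_uninstantiable
    (h : ∃ Θ : SymmetricTolerance, ∀ U ∈ Set.Icc (2:ℝ) 3, ∀ δ ∈ Set.Icc (1/5:ℝ) (7/20), ∀ μ : ℝ,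
      Dens U μ δ → ∀ (K : TrigPolyC4v) (Λ : ℝ) (L₀ : ℕ),
        ¬ symmetricRegimeCertificateT U μ capRgCornerDataT Θ K Λ L₀) :
    SeededBrokenRegimeBoseFermiPinned := by
  obtain ⟨Θ, hΘ⟩ := h
  intro kStar etaStar _ _
  exact ⟨Θ, fun U hU δ hδ μ hd K Λ L₀ hc => absurd hc (hΘ U hU δ hδ μ hd K Λ L₀)⟩

/-- Under the producer crux `[2]` EVERY tolerance is certified at `[2]`'s point of the box: the crux
is then not vacuous at any `Θ`. -/
theorem instantiated_of_capRg (hcap : CapRgSymmetricCertificatePinned) (Θ : SymmetricTolerance) :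
    ∃ U ∈ Set.Icc (2:ℝ) 3, ∃ δ ∈ Set.Icc (1/5:ℝ) (7/20), ∃ μ : ℝ, Dens U μ δ ∧
      ∃ (K : TrigPolyC4v) (Λ : ℝ) (L₀ : ℕ), symmetricRegimeCertificateT U μ capRgCornerDataT Θ K Λ L₀ := by
  obtain ⟨U, hU, δ, hδ, μ, hd, hall⟩ := hcap
  exact ⟨U, hU, δ, hδ, μ, hd, hall Θ⟩

/-- Under `[2]`, the crux delivers its conclusion at `[2]`'s point for all thresholds (the glue
direction, recorded to make "relative" precise: crux ∧ [2] ⊢ ∃ point, ∀ thresholds, Concl). -/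
theorem concl_of_crux_of_capRg (hS : SeededBrokenRegimeBoseFermiPinned)
    (hcap : CapRgSymmetricCertificatePinned) :
    ∃ U ∈ Set.Icc (2:ℝ) 3, ∃ μ : ℝ, ∀ kStar etaStar : ℚ, 0 < kStar → 0 < etaStar →
      Concl kStar etaStar U μ := by
  obtain ⟨U, hU, δ, hδ, μ, hd, hall⟩ := hcap
  refine ⟨U, hU, μ, fun kStar etaStar hk he => ?_⟩
  obtain ⟨Θ, hΘ⟩ := hS kStar etaStar hk he
  obtain ⟨K, Λ, L₀, hc⟩ := hall Θ
  exact hΘ U hU δ hδ μ hd K Λ L₀ hc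

/-! ### §4 Load-bearing analysis (modulo `[2]` where a certified point is needed) -/

/-- **Tightness of `0 < etaStar`**: the conclusion forces `0 ≤ etaStar` (a reported tuple has a
nonnegative remainder norm and is enclosed below `etaStar`).  UNCONDITIONAL. -/
theorem concl_etaStar_nonneg {kStar etaStar : ℚ} {U μ : ℝ} (h : Concl kStar etaStar U μ) :
    0 ≤ etaStar := by
  obtain ⟨h₀, hh₀, D, hmeets, -, -, hencl⟩ := h
  obtain ⟨L₀', hcert⟩ := hencl h₀ ⟨hh₀, le_rfl⟩
  obtain ⟨β₀, hβ₀⟩ := hcert L₀' le_rfl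
  obtain ⟨p, hp, henc⟩ := hβ₀ β₀ le_rfl
  have h0 : 0 ≤ p.remainderNorm :=
    remainderNorm_nonneg_of_mem_reportCT (by exact_mod_cast D.scale_pos.le) hp
  have h1 : p.remainderNorm ≤ (etaStar : ℝ) := hmeets.remainderNorm_le henc
  exact_mod_cast h0.trans h1

/-- The crux with the sign condition on `etaStar` DROPPED. -/
def CruxAnyEta : Prop :=
  ∀ kStar etaStar : ℚ, 0 < kStar → ∃ Θ : SymmetricTolerance, Body kStar etaStar Θ

/-- `CruxAnyEta` is a strengthening of the crux. -/
theorem crux_of_cruxAnyEta (h : CruxAnyEta) : SeededBrokenRegimeBoseFermiPinned :=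
  fun kStar etaStar hk _ => h kStar etaStar hk

/-- **`0 < etaStar` is load-bearing (modulo `[2]`)**: with it dropped the statement is false at the
producer's certified point (witness `etaStar = -1`, `concl_etaStar_nonneg`). -/
theorem not_cruxAnyEta_of_capRg (hcap : CapRgSymmetricCertificatePinned) : ¬ CruxAnyEta := by
  intro h
  obtain ⟨Θ, hΘ⟩ := h 1 (-1) one_pos
  obtain ⟨U, hU, δ, hδ, μ, hd, K, Λ, L₀, hc⟩ := instantiated_of_capRg hcap Θ
  have := concl_etaStar_nonneg (hΘ U hU δ hδ μ hd K Λ L₀ hc)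
  norm_num at this

/-- **No single datum meets all stiffness thresholds** (pure rational arithmetic on the record):
`kStar · Λ₀ · v_F.snd ≤ ρ_s.fst` fails at `kStar = (|ρ_s.fst| + 1)/(Λ₀ · v_F.snd)`. UNCONDITIONAL. -/
theorem not_forall_meetsThresholds (D : HubbardScaleData) (etaStar : ℚ) :
    ¬ ∀ kStar : ℚ, 0 < kStar → D.MeetsThresholds kStar etaStar := by
  intro h
  obtain ⟨-, hvF, -, -⟩ := (h 1 one_pos : D.MeetsThresholdsWith 10 1 etaStar)
  have hv : 0 < D.fermiVelocity.snd := hvF.trans_le D.fermiVelocity.fst_le_snd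
  have hsv : 0 < D.scale * D.fermiVelocity.snd := mul_pos D.scale_pos hv
  set kStar : ℚ := (|D.stiffness.fst| + 1) / (D.scale * D.fermiVelocity.snd) with hk
  have hkpos : 0 < kStar := div_pos (by positivity) hsv
  obtain ⟨-, -, -, h1, -⟩ := (h kStar hkpos : D.MeetsThresholdsWith 10 kStar etaStar)
  have : kStar * D.scale * D.fermiVelocity.snd = |D.stiffness.fst| + 1 := by
    rw [mul_assoc, hk, div_mul_cancel₀ _ hsv.ne']
  linarith [le_abs_self D.stiffness.fst]

/-- The crux with ONE datum for ALL thresholds (`∃ h₀ D` before `∀ kStar etaStar`). -/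
def CruxUniformDatum : Prop :=
  ∃ Θ : SymmetricTolerance, ∀ U ∈ Set.Icc (2:ℝ) 3, ∀ δ ∈ Set.Icc (1/5:ℝ) (7/20), ∀ μ : ℝ, Dens U μ δ →
    ∀ (K : TrigPolyC4v) (Λ : ℝ) (L₀ : ℕ), symmetricRegimeCertificateT U μ capRgCornerDataT Θ K Λ L₀ →
      ∃ h₀ : ℝ, 0 < h₀ ∧ ∃ D : HubbardScaleData,
        (∀ kStar etaStar : ℚ, 0 < kStar → 0 < etaStar → D.MeetsThresholds kStar etaStar) ∧
        0 < D.numPatches ∧ 0 < D.meanFieldDensity.fst ∧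
        ∀ h ∈ Set.Ioc (0:ℝ) h₀, ∃ L₀' : ℕ, D.IsCertifiedEnclosure (hubbardScaleReportCT U μ D h) L₀'

/-- `CruxUniformDatum` is a strengthening of the crux. -/
theorem crux_of_cruxUniformDatum (h : CruxUniformDatum) : SeededBrokenRegimeBoseFermiPinned := by
  obtain ⟨Θ, hΘ⟩ := h
  intro kStar etaStar hk he
  refine ⟨Θ, fun U hU δ hδ μ hd K Λ L₀ hc => ?_⟩
  obtain ⟨h₀, hh₀, D, hD, hNp, hm, hencl⟩ := hΘ U hU δ hδ μ hd K Λ L₀ hc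
  exact ⟨h₀, hh₀, D, hD kStar etaStar hk he, hNp, hm, hencl⟩

/-- **The order `∀ kStar etaStar … ∃ D` is load-bearing (modulo `[2]`)**: the uniform-datum
strengthening is false at the producer's certified point (`not_forall_meetsThresholds`). -/
theorem not_cruxUniformDatum_of_capRg (hcap : CapRgSymmetricCertificatePinned) : ¬ CruxUniformDatum := by
  rintro ⟨Θ, hΘ⟩
  obtain ⟨U, hU, δ, hδ, μ, hd, K, Λ, L₀, hc⟩ := instantiated_of_capRg hcap Θ
  obtain ⟨h₀, -, D, hD, -⟩ := hΘ U hU δ hδ μ hd K Λ L₀ hc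
  exact not_forall_meetsThresholds D 1 fun kStar hk => hD kStar 1 hk one_pos

/-- The crux WITHOUT the density clause and the doping variable (a STRONGER statement: the
certificate and the conclusion never read `δ`). -/
def CruxNoDens : Prop :=
  ∀ kStar etaStar : ℚ, 0 < kStar → 0 < etaStar → ∃ Θ : SymmetricTolerance,
    ∀ U ∈ Set.Icc (2:ℝ) 3, ∀ μ : ℝ, ∀ (K : TrigPolyC4v) (Λ : ℝ) (L₀ : ℕ),
      symmetricRegimeCertificateT U μ capRgCornerDataT Θ K Λ L₀ → Concl kStar etaStar U μ

/-- `CruxNoDens → crux`: the density clause is decoration for the implication (information for the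
prover: nothing in a proof of `[3]` can use it). -/
theorem crux_of_cruxNoDens (h : CruxNoDens) : SeededBrokenRegimeBoseFermiPinned := by
  intro kStar etaStar hk he
  obtain ⟨Θ, hΘ⟩ := h kStar etaStar hk he
  exact ⟨Θ, fun U hU δ _ μ _ K Λ L₀ hc => hΘ U hU μ K Λ L₀ hc⟩

/-! ### §5 Conclusion-side structure: with an empty nodal set the velocities are free -/

/-- Re-assigning the two velocities of a parameter tuple. -/
def setVel {Np : ℕ} (p : HubbardScaleData.Parameters Np) (vF vΔ : ℝ) : HubbardScaleData.Parameters Np :=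
  { p with fermiVelocity := vF, gapVelocity := vΔ }

/-- **With an empty nodal set `IsRealisedAtCT` does not read the velocities.** -/
theorem isRealisedAtCT_setVel {L M : ℕ} [NeZero L] {Np : ℕ} {nodal : Finset (Fin Np)} (hn : nodal = ∅)
    {β U μ h Λ₀ : ℝ} {K : TrigPolyC4v} {p : HubbardScaleData.Parameters Np}
    (hp : IsRealisedAtCT L M β U μ h K Λ₀ Np nodal p) (vF vΔ : ℝ) :
    IsRealisedAtCT L M β U μ h K Λ₀ Np nodal (setVel p vF vΔ) := by
  subst hn
  obtain ⟨hβ, q, hev, hgap, hsign, -, hρ, hκ, hm, hη⟩ := hp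
  exact ⟨hβ, q, hev, hgap, hsign, fun i hi => by simp at hi, hρ, hκ, hm, hη⟩

/-- The CT report with an empty nodal set is closed under re-assigning the velocities. -/
theorem mem_reportCTAt_setVel {U μ h Λ₀ : ℝ} {Np : ℕ} {nodal : Finset (Fin Np)} (hn : nodal = ∅)
    {L : ℕ} {β : ℝ} {p : HubbardScaleData.Parameters Np}
    (hp : p ∈ hubbardScaleReportCTAt U μ h Λ₀ Np nodal L β) (vF vΔ : ℝ) :
    setVel p vF vΔ ∈ hubbardScaleReportCTAt U μ h Λ₀ Np nodal L β := by
  rcases Nat.eq_zero_or_pos L with rfl | hL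
  · simp at hp
  · haveI : NeZero L := NeZero.of_pos hL
    rw [mem_hubbardScaleReportCTAt_iff] at hp ⊢
    intro δ hδ
    refine (hp δ hδ).mono fun M hM => ?_
    obtain ⟨K, hK, p', hp', hclose⟩ := hM
    refine ⟨K, hK, setVel p' vF vΔ, isRealisedAtCT_setVel hn hp' vF vΔ, ?_⟩
    obtain ⟨h1, h2, h3, -, -, h6, h7⟩ := hclose
    exact ⟨h1, h2, h3, by simp [setVel, hδ], by simp [setVel, hδ], h6, h7⟩

/-- Re-assigning the two velocity enclosures of a scale datum. -/
def withVel (D : HubbardScaleData) (I J : NonemptyInterval ℚ) : HubbardScaleData :=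
  { D with fermiVelocity := I, gapVelocity := J }

/-- The report never reads the enclosures: it is the same for `withVel D I J`. -/
theorem reportCT_withVel (U μ h : ℝ) (D : HubbardScaleData) (I J : NonemptyInterval ℚ) :
    hubbardScaleReportCT U μ (withVel D I J) h = hubbardScaleReportCT U μ D h := rfl

/-- **A certified datum with empty nodal set stays certified with ARBITRARY velocity enclosures.** -/
theorem isCertifiedEnclosure_withVel {U μ h : ℝ} {D : HubbardScaleData} (hD : D.nodal = ∅)
    (I J : NonemptyInterval ℚ) {L₀ : ℕ} (hc : D.IsCertifiedEnclosure (hubbardScaleReportCT U μ D h) L₀) :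
    (withVel D I J).IsCertifiedEnclosure (hubbardScaleReportCT U μ (withVel D I J) h) L₀ := by
  intro L hL
  obtain ⟨β₀, hβ₀⟩ := hc L hL
  refine ⟨β₀, fun β hβ => ?_⟩
  obtain ⟨p, hp, henc⟩ := hβ₀ β hβ
  refine ⟨setVel p I.fst J.fst, mem_reportCTAt_setVel hD hp _ _, ?_⟩
  obtain ⟨hg, hρ, hκ, -, -, hη, hm⟩ := henc
  have hI : ((I.fst : ℚ) : ℝ) ∈ I.ratCast ℝ :=
    NonemptyInterval.mem_ratCast_iff.2 ⟨le_rfl, by exact_mod_cast I.fst_le_snd⟩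
  have hJ : ((J.fst : ℚ) : ℝ) ∈ J.ratCast ℝ :=
    NonemptyInterval.mem_ratCast_iff.2 ⟨le_rfl, by exact_mod_cast J.fst_le_snd⟩
  exact ⟨hg, hρ, hκ, hI, hJ, hη, hm⟩

/-- The point interval `[ε, ε]`. -/
def pt (ε : ℚ) : NonemptyInterval ℚ := ⟨(ε, ε), le_rfl⟩

/-- **The velocity clauses of `MeetsThresholds` are decorative on data with empty nodal set**: a
`Concl`-witness with `D.nodal = ∅` can be re-certified with BOTH velocity enclosures equal to the
point `[ε, ε]` for every small rational `ε > 0`, without any model input.  UNCONDITIONAL. -/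
theorem concl_velocities_decorative {kStar etaStar : ℚ} (hk : 0 ≤ kStar) {U μ : ℝ}
    (h : ∃ h₀ : ℝ, 0 < h₀ ∧ ∃ D : HubbardScaleData, D.nodal = ∅ ∧ D.MeetsThresholds kStar etaStar ∧
      0 < D.numPatches ∧ 0 < D.meanFieldDensity.fst ∧
      ∀ h ∈ Set.Ioc (0:ℝ) h₀, ∃ L₀' : ℕ, D.IsCertifiedEnclosure (hubbardScaleReportCT U μ D h) L₀') :
    ∃ ε₀ : ℚ, 0 < ε₀ ∧ ∀ ε : ℚ, 0 < ε → ε ≤ ε₀ →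
      ∃ h₀ : ℝ, 0 < h₀ ∧ ∃ D : HubbardScaleData, D.nodal = ∅ ∧ D.fermiVelocity = pt ε ∧
        D.gapVelocity = pt ε ∧ D.MeetsThresholds kStar etaStar ∧ 0 < D.numPatches ∧
        0 < D.meanFieldDensity.fst ∧
        ∀ h ∈ Set.Ioc (0:ℝ) h₀, ∃ L₀' : ℕ, D.IsCertifiedEnclosure (hubbardScaleReportCT U μ D h) L₀' := by
  obtain ⟨h₀, hh₀, D, hn, hmeets, hNp, hm, hencl⟩ := h
  obtain ⟨hκ, hvF, hvΔ, h1, h2, h3, h4, h5⟩ := (hmeets : D.MeetsThresholdsWith 10 kStar etaStar)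
  refine ⟨min D.fermiVelocity.snd D.gapVelocity.snd,
    lt_min (hvF.trans_le D.fermiVelocity.fst_le_snd) (hvΔ.trans_le D.gapVelocity.fst_le_snd), ?_⟩
  intro ε hε hεle
  refine ⟨h₀, hh₀, withVel D (pt ε) (pt ε), hn, rfl, rfl, ?_, hNp, hm, fun h hh => ?_⟩
  · have hks : 0 ≤ kStar * D.scale := mul_nonneg hk D.scale_pos.le
    refine ⟨hκ, hε, hε, ?_, ?_, h3, h4, h5⟩
    · exact (mul_le_mul_of_nonneg_left (hεle.trans (min_le_left _ _)) hks).trans h1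
    · exact (mul_le_mul_of_nonneg_left (hεle.trans (min_le_right _ _)) hks).trans h2
  · obtain ⟨L₀', hc⟩ := hencl h hh
    exact ⟨L₀', isCertifiedEnclosure_withVel hn _ _ hc⟩

/-! ### §7 Normal forms of the crux (cycle 2) -/

/-- `Concl` is monotone in the thresholds: weaker thresholds (`0 ≤ kStar' ≤ kStar`,
`etaStar ≤ etaStar'`) are met by the same datum (`HubbardScaleData.MeetsThresholds.mono`). -/
theorem concl_mono {kStar kStar' etaStar etaStar' : ℚ} (hk' : 0 ≤ kStar') (hk : kStar' ≤ kStar)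
    (he : etaStar ≤ etaStar') {U μ : ℝ} (h : Concl kStar etaStar U μ) : Concl kStar' etaStar' U μ := by
  obtain ⟨h₀, hh₀, D, hmeets, hNp, hm, hencl⟩ := h
  exact ⟨h₀, hh₀, D, hmeets.mono hk' hk he, hNp, hm, hencl⟩

/-- The body is monotone in the thresholds in the same way. -/
theorem body_mono_thresholds {kStar kStar' etaStar etaStar' : ℚ} (hk' : 0 ≤ kStar') (hk : kStar' ≤ kStar)
    (he : etaStar ≤ etaStar') {Θ : SymmetricTolerance} (h : Body kStar etaStar Θ) :
    Body kStar' etaStar' Θ :=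
  fun U hU δ hδ μ hd K Λ L₀ hc => concl_mono hk' hk he (h U hU δ hδ μ hd K Λ L₀ hc)

/-- The diagonal tolerance `Θ = (ε, ε)`. -/
def diagTol (ε : ℚ) (hε : 0 < ε) : SymmetricTolerance := ⟨ε, hε, ε, hε⟩

/-- **Countable normal form.**  The crux is equivalent to its restriction to the thresholds
`(n+1, 1/(n+1))` and the diagonal tolerances `1/(m+1)`: a `∀ n, ∃ m` statement over `ℕ` in front of the
(model-dependent) body — by antitonicity in `Θ` (§2) and monotonicity in the thresholds. -/
theorem crux_iff_nat :
    SeededBrokenRegimeBoseFermiPinned ↔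
      ∀ n : ℕ, ∃ m : ℕ, Body ((n : ℚ) + 1) (1 / ((n : ℚ) + 1))
        (diagTol (1 / ((m : ℚ) + 1)) (by positivity)) := by
  constructor
  · intro hS n
    obtain ⟨Θ, hΘ⟩ := hS ((n : ℚ) + 1) (1 / ((n : ℚ) + 1)) (by positivity) (by positivity)
    obtain ⟨m, hm⟩ := exists_nat_one_div_lt (lt_min Θ.mismatch_pos Θ.width_pos)
    refine ⟨m, body_antitone ?_ ?_ hΘ⟩
    · exact (hm.trans_le (min_le_left _ _)).le
    · exact (hm.trans_le (min_le_right _ _)).le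
  · intro h kStar etaStar hk he
    obtain ⟨n₁, hn₁⟩ := exists_nat_ge kStar
    obtain ⟨n₂, hn₂⟩ := exists_nat_one_div_lt he
    obtain ⟨m, hm⟩ := h (max n₁ n₂)
    have h1 : (n₁ : ℚ) ≤ ((max n₁ n₂ : ℕ) : ℚ) := by exact_mod_cast le_max_left n₁ n₂
    have h2 : (n₂ : ℚ) ≤ ((max n₁ n₂ : ℕ) : ℚ) := by exact_mod_cast le_max_right n₁ n₂
    refine ⟨_, body_mono_thresholds hk.le (by linarith) ?_ hm⟩
    have : (1 : ℚ) / (((max n₁ n₂ : ℕ) : ℚ) + 1) ≤ 1 / ((n₂ : ℚ) + 1) :=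
      one_div_le_one_div_of_le (by positivity) (by linarith)
    exact this.trans hn₂.le

/-- The body reads its hypothesis only through "some certificate exists at the point": the universally
quantified `K, Λ, L₀` are inert for the conclusion. -/
theorem body_iff_exists (kStar etaStar : ℚ) (Θ : SymmetricTolerance) :
    Body kStar etaStar Θ ↔
      ∀ U ∈ Set.Icc (2:ℝ) 3, ∀ δ ∈ Set.Icc (1/5:ℝ) (7/20), ∀ μ : ℝ, Dens U μ δ →
        (∃ (K : TrigPolyC4v) (Λ : ℝ) (L₀ : ℕ), symmetricRegimeCertificateT U μ capRgCornerDataT Θ K Λ L₀) →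
          Concl kStar etaStar U μ :=
  ⟨fun h U hU δ hδ μ hd ⟨K, Λ, L₀, hc⟩ => h U hU δ hδ μ hd K Λ L₀ hc,
    fun h U hU δ hδ μ hd K Λ L₀ hc => h U hU δ hδ μ hd ⟨K, Λ, L₀, hc⟩⟩

/-! ### §8 The weak (pointwise) producer `[2′]` and the hardness transfer `¬S → [2′]` (cycle 2) -/

/-- **The weak producer `[2′]`**: every tolerance is certified at SOME point of the box carrying the
density clause — the point may depend on `Θ` (`[2]` = `CapRgSymmetricCertificatePinned` fixes ONE point
for all `Θ`, so `[2] → [2′]`, `capRgPointwise_of_capRg`). -/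
def CapRgPointwise : Prop :=
  ∀ Θ : SymmetricTolerance, ∃ U ∈ Set.Icc (2:ℝ) 3, ∃ δ ∈ Set.Icc (1/5:ℝ) (7/20), ∃ μ : ℝ, Dens U μ δ ∧
    ∃ (K : TrigPolyC4v) (Λ : ℝ) (L₀ : ℕ), symmetricRegimeCertificateT U μ capRgCornerDataT Θ K Λ L₀

/-- `[2] → [2′]`. -/
theorem capRgPointwise_of_capRg (h : CapRgSymmetricCertificatePinned) : CapRgPointwise :=
  fun Θ => instantiated_of_capRg h Θ

/-- **Dichotomy**: if `[2′]` fails, some tolerance is certified nowhere in the box and the crux holds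
vacuously (§3). -/
theorem crux_of_not_capRgPointwise (h : ¬ CapRgPointwise) : SeededBrokenRegimeBoseFermiPinned := by
  apply crux_of_uninstantiable
  obtain ⟨Θ, hΘ⟩ := not_forall.mp h
  exact ⟨Θ, fun U hU δ hδ μ hd K Λ L₀ hc => hΘ ⟨U, hU, δ, hδ, μ, hd, K, Λ, L₀, hc⟩⟩

/-- **Hardness transfer**: any refutation of the crux PROVES the weak producer `[2′]` — it must
instantiate the v3 certificate at every tolerance somewhere in the box, density clause included (a CAP at
`U ∈ [2,3]` plus a thermodynamic-limit density theorem).  "No cheap kill", kernel-checked. -/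
theorem capRgPointwise_of_not_crux (h : ¬ SeededBrokenRegimeBoseFermiPinned) : CapRgPointwise := by
  by_contra h'
  exact h (crux_of_not_capRgPointwise h')

/-- `S ∨ [2′]`, unconditionally. -/
theorem crux_or_capRgPointwise : SeededBrokenRegimeBoseFermiPinned ∨ CapRgPointwise := by
  by_cases h : CapRgPointwise
  · exact Or.inr h
  · exact Or.inl (crux_of_not_capRgPointwise h)

/-- **`[2′]` already suffices for the route's glue** (`FixedPointOfCertifiedChain` uses the stronger
`[2]`): R fixes the thresholds, the crux at those thresholds fixes `Θ`, `[2′]` at `Θ` supplies the point.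
Planner information: the producer may choose its point per accuracy.  (Positive glue; work-file only.) -/
theorem fixedPoint_of_pointwise (h2 : CapRgPointwise) (h3 : SeededBrokenRegimeBoseFermiPinned)
    (hR : AposterioriOrderCriterionR) : FixedPointDWaveOrder := by
  obtain ⟨kStar, etaStar, hk, he, hR⟩ := hR
  obtain ⟨Θ, hΘ⟩ := h3 kStar etaStar hk he
  obtain ⟨U, hU, δ, hδ, μ, hd, K, Λ, L₀, hc⟩ := h2 Θ
  obtain ⟨h₀, hh₀, D, hmeets, -, hm, hencl⟩ := hΘ U hU δ hδ μ hd K Λ L₀ hc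
  have hle := hR U μ h₀ D hh₀ hencl hmeets
  refine ⟨U, hU, δ, hδ, μ, hd, ?_⟩
  rw [hasDWaveOrder_iff]
  have : (0:ℝ) < ((D.meanFieldDensity.fst : ℚ) : ℝ) := by exact_mod_cast hm
  linarith

/-- The cycle-1 negative lemmas hold modulo the WEAKER `[2′]`: the crux with the sign condition on
`etaStar` dropped is false. -/
theorem not_cruxAnyEta_of_pointwise (h2 : CapRgPointwise) : ¬ CruxAnyEta := by
  intro h
  obtain ⟨Θ, hΘ⟩ := h 1 (-1) one_pos
  obtain ⟨U, hU, δ, hδ, μ, hd, K, Λ, L₀, hc⟩ := h2 Θ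
  have := concl_etaStar_nonneg (hΘ U hU δ hδ μ hd K Λ L₀ hc)
  norm_num at this

/-- Likewise the uniform-datum strengthening is false modulo `[2′]`. -/
theorem not_cruxUniformDatum_of_pointwise (h2 : CapRgPointwise) : ¬ CruxUniformDatum := by
  rintro ⟨Θ, hΘ⟩
  obtain ⟨U, hU, δ, hδ, μ, hd, K, Λ, L₀, hc⟩ := h2 Θ
  obtain ⟨h₀, -, D, hD, -⟩ := hΘ U hU δ hδ μ hd K Λ L₀ hc
  exact not_forall_meetsThresholds D 1 fun kStar hk => hD kStar 1 hk one_pos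

/-! ### §9 A remainder FLOOR kills the conclusion: `¬S` modulo (weak producer + floor) (cycle 2)

See the module docstring, finding F1, for the ON-PAPER content: the anomalous `B₁g` block of the
pair-fluctuation exchange is NOT kept by `cooperKeptCT` and has a MARGINAL (`Λ₀⁰`, `h⁰`) scaled norm
`c_W ≈ 4·10⁻³–4·10⁻²` in `scaledRemainderNormCT`; the lemmas below turn any such floor into `¬S`. -/

/-- **`NoSmallRemainderData U μ c`** — the datum-level floor at the point `(U, μ)`: for all seeds below
some `h₁`, every datum with at least one patch that is `h`-uniformly certified against the CT report on
`(0, h₀]`, `h₀ ≤ h₁`, has remainder ceiling `≥ c` — unless it fails the unit stiffness thresholds for every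
remainder budget.  Implied by the tuple-level floor (`noSmallRemainderData_of_tupleFloor`). -/
def NoSmallRemainderData (U μ : ℝ) (c : ℝ) : Prop :=
  ∃ h₁ : ℝ, 0 < h₁ ∧ ∀ (D : HubbardScaleData) (h₀ : ℝ), 0 < h₀ → h₀ ≤ h₁ → 0 < D.numPatches →
    (∀ h ∈ Set.Ioc (0:ℝ) h₀, ∃ L₀' : ℕ, D.IsCertifiedEnclosure (hubbardScaleReportCT U μ D h) L₀') →
      c ≤ D.remainderNorm.snd ∨ ∀ η : ℚ, ¬ D.MeetsThresholds 1 η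

/-- **A floor kills the conclusion**: under `NoSmallRemainderData U μ c`, `Concl kStar etaStar U μ` fails
for every `kStar ≥ 1` and every rational `etaStar < c`.  UNCONDITIONAL. -/
theorem not_concl_of_noSmallRemainderData {U μ c : ℝ} (hfl : NoSmallRemainderData U μ c)
    {kStar etaStar : ℚ} (hk : 1 ≤ kStar) (he : (etaStar : ℝ) < c) : ¬ Concl kStar etaStar U μ := by
  rintro ⟨h₀, hh₀, D, hmeets, hNp, -, hencl⟩
  obtain ⟨h₁, hh₁, hfl⟩ := hfl
  have hmeets1 : D.MeetsThresholds 1 etaStar := hmeets.mono zero_le_one hk le_rfl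
  rcases hfl D (min h₀ h₁) (lt_min hh₀ hh₁) (min_le_right _ _) hNp
      (fun h hh => hencl h ⟨hh.1, hh.2.trans (min_le_left _ _)⟩) with hc | hno
  · have h5 : D.remainderNorm.snd ≤ etaStar :=
      (hmeets1 : D.MeetsThresholdsWith 10 1 etaStar).2.2.2.2.2.2.2
    have h5' : ((D.remainderNorm.snd : ℚ) : ℝ) ≤ etaStar := by exact_mod_cast h5
    linarith
  · exact hno etaStar hmeets1

/-- **`[2′]` with a floor `c`**: every tolerance is certified at some point of the box (density clause
included) at which `NoSmallRemainderData · · c` holds. -/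
def CapRgPointwiseFloor (c : ℝ) : Prop :=
  ∀ Θ : SymmetricTolerance, ∃ U ∈ Set.Icc (2:ℝ) 3, ∃ δ ∈ Set.Icc (1/5:ℝ) (7/20), ∃ μ : ℝ, Dens U μ δ ∧
    (∃ (K : TrigPolyC4v) (Λ : ℝ) (L₀ : ℕ), symmetricRegimeCertificateT U μ capRgCornerDataT Θ K Λ L₀) ∧
      NoSmallRemainderData U μ c

/-- Forgetting the floor. -/
theorem capRgPointwise_of_floor {c : ℝ} (h : CapRgPointwiseFloor c) : CapRgPointwise := by
  intro Θ
  obtain ⟨U, hU, δ, hδ, μ, hd, hcert, -⟩ := h Θ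
  exact ⟨U, hU, δ, hδ, μ, hd, hcert⟩

/-- **THE CYCLE-2 NEGATIVE LEMMA: a positive remainder floor at the certified points refutes the crux**
(`kStar := 1`, `etaStar :=` a rational in `(0, c)`). -/
theorem crux_false_of_floor {c : ℝ} (hc : 0 < c) (h : CapRgPointwiseFloor c) :
    ¬ SeededBrokenRegimeBoseFermiPinned := by
  intro hS
  obtain ⟨η, hη0, hηc⟩ := exists_rat_btwn hc
  obtain ⟨Θ, hΘ⟩ := hS 1 η one_pos (by exact_mod_cast hη0)
  obtain ⟨U, hU, δ, hδ, μ, hd, ⟨K, Λ, L₀, hcert⟩, hfl⟩ := h Θ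
  exact not_concl_of_noSmallRemainderData hfl le_rfl hηc (hΘ U hU δ hδ μ hd K Λ L₀ hcert)

/-- The floor hypothesis in the shape of the route's OWN producer `[2]`: one point for all tolerances,
carrying the density clause, every certificate, and the floor. -/
def CapRgFloor (c : ℝ) : Prop :=
  ∃ U ∈ Set.Icc (2:ℝ) 3, ∃ δ ∈ Set.Icc (1/5:ℝ) (7/20), ∃ μ : ℝ, Dens U μ δ ∧
    (∀ Θ : SymmetricTolerance, ∃ (K : TrigPolyC4v) (Λ : ℝ) (L₀ : ℕ),
      symmetricRegimeCertificateT U μ capRgCornerDataT Θ K Λ L₀) ∧ NoSmallRemainderData U μ c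

/-- `CapRgFloor c → [2]`. -/
theorem capRg_of_capRgFloor {c : ℝ} (h : CapRgFloor c) : CapRgSymmetricCertificatePinned := by
  obtain ⟨U, hU, δ, hδ, μ, hd, hall, -⟩ := h
  exact ⟨U, hU, δ, hδ, μ, hd, hall⟩

/-- `CapRgFloor c → CapRgPointwiseFloor c`. -/
theorem capRgPointwiseFloor_of_capRgFloor {c : ℝ} (h : CapRgFloor c) : CapRgPointwiseFloor c := by
  obtain ⟨U, hU, δ, hδ, μ, hd, hall, hfl⟩ := h
  exact fun Θ => ⟨U, hU, δ, hδ, μ, hd, hall Θ, hfl⟩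

/-- **`[2]` with a floor at its point refutes the crux.** -/
theorem crux_false_of_capRgFloor {c : ℝ} (hc : 0 < c) (h : CapRgFloor c) :
    ¬ SeededBrokenRegimeBoseFermiPinned :=
  crux_false_of_floor hc (capRgPointwiseFloor_of_capRgFloor h)

/-- **`H_floor`**, the hypothesis of the cycle-2 negative lemma in one `Prop`: SOME positive floor is
carried by the weak producer's certified points. [topic MathematicalPhysics/QuantumLattice]
Physically EXPECTED at the corner (finding F1: the anomalous `B₁g` block alone gives
`c ≈ 4·10⁻³–4·10⁻²`, `h`- and `Λ₀`-uniformly), but not constructible in the tree: it contains the CAP of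
`[2]`/`[2′]` and a floor theorem for the interacting model at `U ∈ [2,3]`. -/
def AnomalousBlockFloorHyp : Prop := ∃ c : ℝ, 0 < c ∧ CapRgPointwiseFloor c

/-- **`¬ SeededBrokenRegimeBoseFermiPinned` modulo `AnomalousBlockFloorHyp`.** -/
theorem crux_false_of_anomalousBlockFloorHyp (h : AnomalousBlockFloorHyp) :
    ¬ SeededBrokenRegimeBoseFermiPinned := by
  obtain ⟨c, hc, h⟩ := h
  exact crux_false_of_floor hc h

/-- **The tuple-level floor implies the datum-level one.**  If at `(U, μ)`, for all seeds `h ∈ (0, h₁]`,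
(a) every datum of scale `≤ Λ₁` has — for arbitrarily large `L` and then arbitrarily large `β` — only
reported tuples with scaled remainder `≥ c`, and (b) every datum of scale `> Λ₁` has, in the same sense,
only reported tuples with `ρ_s κ < Λ₁²`, then `NoSmallRemainderData U μ c`.  ((a) is the anomalous-block
floor where `Λ₀ ≤ Λ₁ ≲ 1`; (b) says a datum at a scale above the physical `√(ρ_s κ)` cannot meet the unit
stiffness threshold — both physically expected, neither provable here.) -/
theorem noSmallRemainderData_of_tupleFloor {U μ c h₁ : ℝ} (hh₁ : 0 < h₁) {Λ₁ : ℚ} (hΛ₁ : 0 < Λ₁)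
    (ha : ∀ D : HubbardScaleData, D.scale ≤ Λ₁ → ∀ h ∈ Set.Ioc (0:ℝ) h₁, ∀ L₀ : ℕ, ∃ L ≥ L₀,
      ∀ β₀ : ℝ, ∃ β ≥ β₀, ∀ p ∈ hubbardScaleReportCT U μ D h L β, c ≤ p.remainderNorm)
    (hb : ∀ D : HubbardScaleData, Λ₁ < D.scale → ∀ h ∈ Set.Ioc (0:ℝ) h₁, ∀ L₀ : ℕ, ∃ L ≥ L₀,
      ∀ β₀ : ℝ, ∃ β ≥ β₀, ∀ p ∈ hubbardScaleReportCT U μ D h L β,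
        p.stiffness * p.compressibility < ((Λ₁ : ℚ) : ℝ) ^ 2) :
    NoSmallRemainderData U μ c := by
  refine ⟨h₁, hh₁, fun D h₀ hh₀ hle hNp hcert => ?_⟩
  obtain ⟨L₀', hL₀'⟩ := hcert h₀ ⟨hh₀, le_rfl⟩
  have hh : h₀ ∈ Set.Ioc (0:ℝ) h₁ := ⟨hh₀, hle⟩
  rcases le_or_gt D.scale Λ₁ with hs | hs
  · left
    obtain ⟨L, hL, hLβ⟩ := ha D hs h₀ hh L₀'
    obtain ⟨β₀, hβ₀⟩ := hL₀' L hL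
    obtain ⟨β, hβ, hp⟩ := hLβ β₀
    obtain ⟨p, hpR, henc⟩ := hβ₀ β hβ
    obtain ⟨-, -, -, -, -, hη, -⟩ := henc
    rw [NonemptyInterval.mem_ratCast_iff] at hη
    exact (hp p hpR).trans hη.2
  · right
    intro η hmeets
    obtain ⟨hκ, -, -, -, -, h3, -⟩ := (hmeets : D.MeetsThresholdsWith 10 1 η)
    obtain ⟨L, hL, hLβ⟩ := hb D hs h₀ hh L₀'
    obtain ⟨β₀, hβ₀⟩ := hL₀' L hL
    obtain ⟨β, hβ, hp⟩ := hLβ β₀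
    obtain ⟨p, hpR, henc⟩ := hβ₀ β hβ
    have hlt := hp p hpR
    obtain ⟨-, hρ, hκp, -⟩ := henc
    rw [NonemptyInterval.mem_ratCast_iff] at hρ hκp
    have hκ' : (0:ℝ) < ((D.compressibility.fst : ℚ) : ℝ) := by exact_mod_cast hκ
    have h3' : ((D.scale : ℚ) : ℝ) ^ 2 ≤ ((D.stiffness.fst : ℚ) : ℝ) * D.compressibility.fst := by
      rw [one_mul] at h3; exact_mod_cast h3
    have hsc : ((Λ₁ : ℚ) : ℝ) < ((D.scale : ℚ) : ℝ) := by exact_mod_cast hs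
    have hΛ₁' : (0:ℝ) < ((Λ₁ : ℚ) : ℝ) := by exact_mod_cast hΛ₁
    have hρ0 : (0:ℝ) ≤ ((D.stiffness.fst : ℚ) : ℝ) := by
      refine le_of_not_gt fun hneg => ?_
      have : ((D.stiffness.fst : ℚ) : ℝ) * D.compressibility.fst < 0 := mul_neg_of_neg_of_pos hneg hκ'
      nlinarith
    have hprod : ((D.stiffness.fst : ℚ) : ℝ) * D.compressibility.fst ≤ p.stiffness * p.compressibility :=
      calc ((D.stiffness.fst : ℚ) : ℝ) * D.compressibility.fst
          ≤ D.stiffness.fst * p.compressibility := mul_le_mul_of_nonneg_left hκp.1 hρ0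
        _ ≤ p.stiffness * p.compressibility := mul_le_mul_of_nonneg_right hρ.1 (hκ'.le.trans hκp.1)
    nlinarith

/-- **From realised to reported tuples**: a floor on the remainder norm of every tuple REALISED at `(L, β)`
(in any admissible frame, for all large `M`) is a floor on every REPORTED tuple there — the report is a Kuratowski
upper limit of `δ`-closures of realised sets (as `remainderNorm_nonneg_of_mem_reportCT`).  This is the form in which
a prover meets hypothesis (a) of `noSmallRemainderData_of_tupleFloor`. -/
theorem reportFloor_of_realisedFloor {U μ h Λ₀ c : ℝ} {Np : ℕ} {nodal : Finset (Fin Np)} {L : ℕ} [NeZero L]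
    {β : ℝ} (hfl : ∀ᶠ M in Filter.atTop, ∀ (K : TrigPolyC4v) (p' : HubbardScaleData.Parameters Np),
      IsAdmissibleFrame K → IsRealisedAtCT L M β U μ h K Λ₀ Np nodal p' → c ≤ p'.remainderNorm)
    {p : HubbardScaleData.Parameters Np} (hp : p ∈ hubbardScaleReportCTAt U μ h Λ₀ Np nodal L β) :
    c ≤ p.remainderNorm := by
  rw [mem_hubbardScaleReportCTAt_iff] at hp
  refine le_of_forall_pos_lt_add fun δ hδ => ?_
  obtain ⟨M, ⟨K, hK, p', hp', hclose⟩, hM⟩ := ((hp δ hδ).and_eventually hfl).exists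
  have h1 : c ≤ p'.remainderNorm := hM K p' hK hp'
  have h2 := hclose.2.2.2.2.2.1
  rw [abs_lt] at h2
  linarith

/-! ### §10 Targets (cycle 2): the picked line `seed-strength-flow` (PICKED.md 04:14Z; skeleton
`Lines/seed-strength-flow.lean`, stubs S1–S6)

F1 bears on the two crux-strength stubs.  S5 `stub_seedLowering` (STEP) promises, for EVERY `etaStar`, a datum
`D'` meeting `(kStar, etaStar)` certified at every seed `h ∈ (0, D.scale/4]`; its docstring's premise "whose only soft
channel is the rank-one `B₁g` transverse ladder housed in `cooperKeptCT`" is exactly what F1 refutes: the ANOMALOUS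
half of that ladder is not housed in `cooperKeptCT`, and as `h ↓ 0` it reaches the marginal floor `c_W ≈ 0.033/v_F²`
— so S5 is false ON PAPER for `etaStar < c_W` at every certified point carrying an anchored datum (= S4's output).
S4 `stub_anchorFlow` (ANCHOR, seed `h₀ = Λ₀/4`, transverse mass `m ≈ 12–20Λ₀`): the anomalous block is suppressed by
`≈ 6·10⁻³–2.5·10⁻³` relative to the massless case (lite numerics `calc/floor_W_lite_results.md`, same integrator as the
massless table, `m/Λ₀ = 12–20`) but is STILL marginal (`m/Λ₀` is fixed by `h₀ = Λ₀/4`): floor `≈ (2–4)·10⁻⁵` at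
`v_F = 2` — S4's `etaStar/2` is unmeetable only below that ("false in principle", harmless with literal thresholds).
Checked shell for S5 below: `stub_seedLowering_false_of_targetFloorHyp`. -/

/-- The statement of the lead's stub S5 `stub_seedLowering`, verbatim (`Lines/seed-strength-flow.lean` l. 109–119). -/
def StubSeedLowering : Prop :=
  ∀ kStar etaStar : ℚ, 0 < kStar → 0 < etaStar → ∃ Θ : SymmetricTolerance,
    ∀ U ∈ Set.Icc (2:ℝ) 3, ∀ (μ : ℝ) (K : TrigPolyC4v) (Λ : ℝ) (L₀ : ℕ),
      symmetricRegimeCertificateT U μ capRgCornerDataT Θ K Λ L₀ →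
        ∀ D : HubbardScaleData, D.MeetsThresholdsWith 20 (2 * kStar) (etaStar / 2) → 0 < D.numPatches →
          0 < D.meanFieldDensity.fst →
          (∃ L₀' : ℕ, D.IsCertifiedEnclosure (hubbardScaleReportCT U μ D ((D.scale : ℝ) / 4)) L₀') →
            ∃ D' : HubbardScaleData, D'.scale = D.scale ∧ D'.MeetsThresholds kStar etaStar ∧
              0 < D'.numPatches ∧ 0 < D'.meanFieldDensity.fst ∧
              ∀ h ∈ Set.Ioc (0:ℝ) ((D.scale : ℝ) / 4), ∃ L₀' : ℕ,
                D'.IsCertifiedEnclosure (hubbardScaleReportCT U μ D' h) L₀'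

/-- **Anchored data exist at `(U, μ)`** — the shape of S4's output at the point, for all thresholds (what one must feed
S5 to extract its conclusion). -/
def AnchoredDataAt (U μ : ℝ) : Prop :=
  ∀ kStar etaStar : ℚ, 0 < kStar → 0 < etaStar → ∃ D : HubbardScaleData,
    D.MeetsThresholdsWith 20 (2 * kStar) (etaStar / 2) ∧ 0 < D.numPatches ∧ 0 < D.meanFieldDensity.fst ∧
      ∃ L₀' : ℕ, D.IsCertifiedEnclosure (hubbardScaleReportCT U μ D ((D.scale : ℝ) / 4)) L₀'

/-- **`H₅`** for the target S5: some floor `c > 0` such that every tolerance is certified (NO density clause needed) at a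
point carrying the datum-level floor AND anchored data.  As unconstructible as `AnomalousBlockFloorHyp` (plus S4). -/
def TargetFloorHyp (c : ℝ) : Prop :=
  ∀ Θ : SymmetricTolerance, ∃ U ∈ Set.Icc (2:ℝ) 3, ∃ μ : ℝ,
    (∃ (K : TrigPolyC4v) (Λ : ℝ) (L₀ : ℕ), symmetricRegimeCertificateT U μ capRgCornerDataT Θ K Λ L₀) ∧
      NoSmallRemainderData U μ c ∧ AnchoredDataAt U μ

/-- **Target S5 modulo `H₅`: `stub_seedLowering` is false under a positive floor at an anchored certified point**
(`kStar := 1`, `etaStar :=` a rational in `(0, c)`; the loosened datum `D'` S5 returns is `h`-uniformly certified on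
`(0, min(D.scale/4, h₁)]` and meets `(1, etaStar)`, which the floor forbids). -/
theorem stub_seedLowering_false_of_targetFloorHyp {c : ℝ} (hc : 0 < c) (hH : TargetFloorHyp c) :
    ¬ StubSeedLowering := by
  intro hS
  obtain ⟨η, hη0, hηc⟩ := exists_rat_btwn hc
  have hη0' : (0 : ℚ) < η := by exact_mod_cast hη0
  obtain ⟨Θ, hΘ⟩ := hS 1 η one_pos hη0'
  obtain ⟨U, hU, μ, ⟨K, Λ, L₀, hcert⟩, hfl, hanch⟩ := hH Θ
  obtain ⟨D, hmeets, hNp, hm, hanc⟩ := hanch 1 η one_pos hη0'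
  obtain ⟨D', -, hmeets', hNp', -, hall⟩ := hΘ U hU μ K Λ L₀ hcert D hmeets hNp hm hanc
  obtain ⟨h₁, hh₁, hfl⟩ := hfl
  have hs4 : (0:ℝ) < (D.scale : ℝ) / 4 := by have := D.cast_scale_pos; positivity
  rcases hfl D' (min ((D.scale : ℝ) / 4) h₁) (lt_min hs4 hh₁) (min_le_right _ _) hNp'
      (fun h hh => hall h ⟨hh.1, hh.2.trans (min_le_left _ _)⟩) with hcle | hno
  · have h5 : D'.remainderNorm.snd ≤ η := (hmeets' : D'.MeetsThresholdsWith 10 1 η).2.2.2.2.2.2.2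
    have h5' : ((D'.remainderNorm.snd : ℚ) : ℝ) ≤ η := by exact_mod_cast h5
    linarith
  · exact hno η hmeets'

/-! ### §11 Frame freedom (cycle 3, finding F6): constant / far-shell frames are admissible

The CT report `∃`-binds an admissible frame `K` (`K.coeffNorm 2 ≤ 16`) inside the realised set, per `(M, δ)`.  The lemmas
below record that CONSTANT frames `K ≡ c` with `|c| ≤ 16` are admissible and that in such a frame every CT object is the
bare object at the shifted chemical potential `μ + c`: the below-scale shell is the level set `{|ε − μ − c| < Λ₀}`, which for
`|c| ≲ 4` lies ON the torus but far from the physical Fermi curve.  What this does to `Concl` and to the floor is F6 of the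
module docstring (on paper): the normal shift `n ≡ c` restores the physical dispersion, the free nodal offset `s_i` admits
displaced cones, every below-scale leg weight is `√(Λ₀/|c|)`, and the anomalous-block floor survives with constant
`≈ c_W (Δ₀/|c|)²`. -/

/-- The constant frame `K ≡ c` (degree `0`, `κ_{0,0} = c`; `h_{0,0} = 1`). -/
def constFrame (c : ℝ) : TrigPolyC4v := ⟨0, fun _ _ => c⟩

/-- A constant frame evaluates to its constant. -/
@[simp] theorem constFrame_eval (c : ℝ) (p : Fin 2 → ℝ) : (constFrame c).eval p = c := by
  simp [constFrame, TrigPolyC4v.eval]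

/-- Every coefficient weight of the constant frame is `|c|`. -/
@[simp] theorem constFrame_coeffNorm (r : ℕ) (c : ℝ) : (constFrame c).coeffNorm r = |c| := by
  simp [constFrame, TrigPolyC4v.coeffNorm]

/-- **Constant frames with `|c| ≤ 16` are ADMISSIBLE for the CT report** (`reportFrameBound = 16`): the report's `∃ K`
ranges over frames that move the below-scale shell anywhere in `{|ε − μ − c| < Λ₀}`, `|c| ≤ 16`. -/
theorem isAdmissibleFrame_constFrame {c : ℝ} (hc : |c| ≤ 16) : IsAdmissibleFrame (constFrame c) := by
  rw [isAdmissibleFrame_iff, constFrame_coeffNorm]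
  exact hc

/-- In a constant frame the renormalised band is the BARE band at chemical potential `μ + c`. -/
theorem nambuXiCT_constFrame (L : ℕ) (μ c : ℝ) (k : Literature.Probability.LatticeModels.TorusSite 2 L) :
    nambuXiCT L μ (constFrame c) k = nambuXi L (μ + c) k := by
  rw [nambuXiCT_eq_nambuXi, constFrame_eval]

/-- In a constant frame the below-scale spatial shell is the bare shell around the level set `{ε = μ + c}`. -/
theorem inShellCT_constFrame (L : ℕ) (μ c Λ₀ : ℝ) (k : Literature.Probability.LatticeModels.TorusSite 2 L) :
    InShellCT L μ (constFrame c) Λ₀ k ↔ InShell L (μ + c) Λ₀ k := by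
  rw [InShellCT, nambuXiCT_constFrame, InShell]

/-- In a constant frame Salmhofer's CT cutoff weights are the bare weights at chemical potential `μ + c` (so the scale
decomposition of `hubbardEffectiveActionCT … (constFrame c) Λ₀` is the bare one centred on `{ε = μ + c}`). -/
theorem hubbardCutoffWeightCT_constFrame (L M : ℕ) (β μ c Λ : ℝ) (k : FreqMomentum L M) :
    hubbardCutoffWeightCT L M β μ (constFrame c) Λ k = hubbardCutoffWeight L M β (μ + c) Λ k := by
  rw [hubbardCutoffWeightCT_eq_hubbardCutoffWeight, constFrame_eval]

/-- A constant frame has zero gradient. -/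
theorem evalGrad_constFrame (c : ℝ) (p : Fin 2 → ℝ) : (constFrame c).evalGrad p = 0 := by
  funext i
  fin_cases i <;> simp [constFrame, TrigPolyC4v.evalGrad, TrigPolyC4v.harmonicGrad]

/-- In a constant frame the renormalised band gradient is the bare one: a patch declared nodal reports the BARE Fermi speed
`|∇ε(κ_i)|` at the displaced reference node `κ_i ∈ {ε = μ + c}` (times the free `(1+r_i)/(1+z_i)`). -/
theorem bandGradientCT_constFrame (c : ℝ) (p : Fin 2 → ℝ) : bandGradientCT (constFrame c) p = bandGradient p := by
  rw [bandGradientCT, evalGrad_constFrame, sub_zero]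

/-! ### §12 Targets (cycle 3): S4 `stub_anchorFlow` modulo an anchor floor

The lead handed the line back with `promote-stub: stub_anchorFlow` (S5 second); `stuck_stubs = []`.  For the record before
promotion: S4 promises, for EVERY `etaStar`, a datum meeting `(2·kStar, etaStar/2)` with gap ratio `20`, certified at the ONE
anchor seed `h₀ = D.scale/4`.  The anomalous block is then massive (`m_⊥ ≈ 12–20 Λ₀`) but still not kept: anchor floor
`c_anchor ≈ (2–4)·10⁻⁵` at `v_F = 2` (g2), times `(Δ₀/|c|)²` in a far-shell frame (F6).  Checked shell below. -/

/-- The statement of the lead's stub S4 `stub_anchorFlow`, verbatim (`Lines/seed-strength-flow.lean`). -/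
def StubAnchorFlow : Prop :=
  ∀ kStar etaStar : ℚ, 0 < kStar → 0 < etaStar → ∃ Θ : SymmetricTolerance,
    ∀ U ∈ Set.Icc (2:ℝ) 3, ∀ (μ : ℝ) (K : TrigPolyC4v) (Λ : ℝ) (L₀ : ℕ),
      symmetricRegimeCertificateT U μ capRgCornerDataT Θ K Λ L₀ →
        ∃ D : HubbardScaleData, D.MeetsThresholdsWith 20 (2 * kStar) (etaStar / 2) ∧ 0 < D.numPatches ∧
          0 < D.meanFieldDensity.fst ∧
          ∃ L₀' : ℕ, D.IsCertifiedEnclosure (hubbardScaleReportCT U μ D ((D.scale : ℝ) / 4)) L₀'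

/-- **Anchor-seed floor at `(U, μ)`**: every datum with a patch that is certified against the CT report at ITS OWN anchor seed
`D.scale/4` has remainder ceiling `≥ c`, or meets the slack thresholds (gap ratio `20`, stiffness `2`) for no budget. -/
def NoSmallRemainderDataAtAnchor (U μ c : ℝ) : Prop :=
  ∀ D : HubbardScaleData, 0 < D.numPatches →
    (∃ L₀' : ℕ, D.IsCertifiedEnclosure (hubbardScaleReportCT U μ D ((D.scale : ℝ) / 4)) L₀') →
      c ≤ D.remainderNorm.snd ∨ ∀ η : ℚ, ¬ D.MeetsThresholdsWith 20 2 η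

/-- **`H₄`** for target S4: every tolerance is certified (no density clause) at a point carrying the anchor floor `c`.
As unconstructible as `AnomalousBlockFloorHyp`. -/
def AnchorFloorHyp (c : ℝ) : Prop :=
  ∀ Θ : SymmetricTolerance, ∃ U ∈ Set.Icc (2:ℝ) 3, ∃ μ : ℝ,
    (∃ (K : TrigPolyC4v) (Λ : ℝ) (L₀ : ℕ), symmetricRegimeCertificateT U μ capRgCornerDataT Θ K Λ L₀) ∧
      NoSmallRemainderDataAtAnchor U μ c

/-- **Target S4 modulo `H₄`: `stub_anchorFlow` is false under a positive anchor floor at a certified point** (`kStar := 1`,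
`etaStar :=` a rational in `(0, c)`: the anchored datum S4 returns meets `MeetsThresholdsWith 20 2 (etaStar/2)` with remainder
ceiling `≤ etaStar/2 < c`, which the anchor floor forbids). -/
theorem stub_anchorFlow_false_of_anchorFloorHyp {c : ℝ} (hc : 0 < c) (hH : AnchorFloorHyp c) : ¬ StubAnchorFlow := by
  intro hS
  obtain ⟨η, hη0, hηc⟩ := exists_rat_btwn hc
  have hη0' : (0 : ℚ) < η := by exact_mod_cast hη0
  obtain ⟨Θ, hΘ⟩ := hS 1 η one_pos hη0'
  obtain ⟨U, hU, μ, ⟨K, Λ, L₀, hcert⟩, hfl⟩ := hH Θ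
  obtain ⟨D, hmeets, hNp, -, hanc⟩ := hΘ U hU μ K Λ L₀ hcert
  have hmeets2 : D.MeetsThresholdsWith 20 2 (η / 2) := by simpa using hmeets
  rcases hfl D hNp hanc with hcle | hno
  · have h5 : D.remainderNorm.snd ≤ η / 2 := hmeets2.2.2.2.2.2.2.2
    have h5' : ((D.remainderNorm.snd : ℚ) : ℝ) ≤ (η : ℝ) / 2 := by exact_mod_cast h5
    linarith
  · exact hno (η / 2) hmeets2

/-- The anchor floor is implied by the datum-level floor of §9 restricted to anchored certification — NOT: §9's
`NoSmallRemainderData` needs certification on a whole interval `(0, h₀]`, S4 certifies ONE seed; the two floors are logically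
independent hypotheses (recorded so nobody composes them).  What does hold: a datum meeting the slack thresholds meets the unit
ones (`MeetsThresholdsWith.mono`), so an anchor floor phrased with `MeetsThresholds 1 η` implies the one above. -/
theorem noSmallRemainderDataAtAnchor_of_unit {U μ c : ℝ}
    (h : ∀ D : HubbardScaleData, 0 < D.numPatches →
      (∃ L₀' : ℕ, D.IsCertifiedEnclosure (hubbardScaleReportCT U μ D ((D.scale : ℝ) / 4)) L₀') →
        c ≤ D.remainderNorm.snd ∨ ∀ η : ℚ, ¬ D.MeetsThresholds 1 η) :
    NoSmallRemainderDataAtAnchor U μ c := by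
  intro D hNp hanc
  rcases h D hNp hanc with hc | hno
  · exact Or.inl hc
  · exact Or.inr fun η hη => hno η (hη.mono (by norm_num) zero_le_one (by norm_num) le_rfl)

/-! ### §13 The normal form of `¬S` (cycle 3; landed as `Negative.not_seededBrokenRegimeBoseFermiPinned_iff`) -/

/-- **What a refutation must exhibit**: `¬S` iff SOME positive thresholds such that EVERY tolerance is certified at a point of
the box (density clause included) where `Concl` fails.  With §8: the certified points are exactly what `[2′]` asks for. -/
theorem not_crux_iff :
    ¬ SeededBrokenRegimeBoseFermiPinned ↔
      ∃ kStar etaStar : ℚ, 0 < kStar ∧ 0 < etaStar ∧ ∀ Θ : SymmetricTolerance,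
        ∃ U ∈ Set.Icc (2:ℝ) 3, ∃ δ ∈ Set.Icc (1/5:ℝ) (7/20), ∃ μ : ℝ, Dens U μ δ ∧
          ∃ (K : TrigPolyC4v) (Λ : ℝ) (L₀ : ℕ), symmetricRegimeCertificateT U μ capRgCornerDataT Θ K Λ L₀ ∧
            ¬ Concl kStar etaStar U μ := by
  rw [crux_iff]
  simp only [Body]
  push Not
  rfl

/-- Under a refutation's witnesses the thresholds may be taken `(1, etaStar)` with `etaStar` as small as one likes — no: they may be
taken LARGER in `kStar` and SMALLER in `etaStar` only (`Concl` is monotone the other way, §7).  Recorded as the one-directional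
transport: a refutation at `(kStar, etaStar)` is one at every `(kStar', etaStar')` with `kStar ≤ kStar'`, `0 < etaStar' ≤ etaStar`. -/
theorem not_concl_mono {kStar kStar' etaStar etaStar' : ℚ} (hk0 : 0 ≤ kStar) (hk : kStar ≤ kStar')
    (he : etaStar' ≤ etaStar) {U μ : ℝ} (h : ¬ Concl kStar etaStar U μ) : ¬ Concl kStar' etaStar' U μ :=
  fun h' => h (concl_mono hk0 hk he h')

end Summit.HubbardSuperconductivity.HubbardSuperconductivity.Cruxes.SeededBrokenRegimeBoseFermiPinned.Disproof
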